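import Literature.MathematicalPhysics.QuantumFieldTheory.BalabanImbrieJaffe1984to88.BIJ85Prop12BridgeGeometry

/-!
# `BalabanImbrieJaffe1984to88.BIJ85Prop12BridgeSup` — [BalabanImbrieJaffe1985] Sect. 7.2 p. 325 *"a consequence of Proposition 1.2 … of
[6I]"*, with [6I] = [Balaban1984PropagatorsI] Prop. 1.2 (1.110) p. 35: file 2 of the Prop. 1.2 FAMILY BRIDGE (file 1
`…BIJ85Prop12BridgeGeometry`): THE KERNELS AND THE SUP MEMBERS (1.110), n = 0, 1.

statement-level skeleton of published theorems with citation tags; proofs where landed; nothing here is a claim about the Yang–Mills mass gap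

CITATION HEADER (lean-in-tree rule).  Part of the lit-balaban TYPED SKELETON (HOME `run/shared/lean/pub/lit-balaban/`), Phase-2 proof seat p19
gen 6; rows B5.Prop1.2 (proved, owner r02) → C1.Eq7.2.1-7.2.2 / C1.Eq7.2.4 / C2.Eq2.16–2.19 (consumers of `B5.Prop12Printed` for p09's family;
fold owner r15 free target HOME/STATUS 2026-08-21T20:16:20Z).

THE PRINTED TEXT (verbatim, [6I] p. 35 [PDF 19]): *"Proposition 1.2. There exists a positive constant δ₀ depending on d only, such that
|(GJ)(x)|, |(∇GJ)(x)|, |(G∇*J)(x)|, |(ΔGJ)(x)| ≤ O(1)e^{−δ₀|y−y′|}|J| (1.110) for x ∈ Δ̃(y), supp J ⊂ Δ̃(y′), with the constant O(1) depending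
on d only"*; p. 35: *"Cubes Δ(y) are simply unit cubes of T_η, or Δ(y) = B^k(y), y ∈ T₁^{(k)}."*

WHAT IS PROVED (`n = L^k`, `M = Mk P k`, `EK : Site P 0 ≃ Tor (fine n M)` p09's identification, `R = torusRep P k (deltaAData hk a)` p09's Sect. 7.2
carrier with `G_k = Δ_a⁻¹`, `∇G_k`):
* §1 the transported sources `srcC`/`srcR` (a real fine vector field of `T^{(0)}` read on the product torus) and THE KERNEL DICTIONARY:
  **`Gk_mulVec_apply`** `(G_kJ)_μ(x) = Re((Δ_a⁻¹ J^c)_μ(EK x))` and **`DGk_mulVec_apply`** `(∇_λG_kJ)_μ(x) = Re((∇_λ Δ_a⁻¹J^c)_μ(EK x))`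
  (r02's `B5Prop11Lattice.grad`), i.e. p09's kernels ARE r02's operator `(B5DeltaA169.DeltaA n M a)⁻¹` and its forward gradient;
* §2 supports and norms through the dictionary: the block pieces `J1_{Δ(y″)}` (`Rep103.blockRestr`) are supported in the product cubes
  `Δ̃(y″)` (`suppInL_srcR_blockRestr`), `|J^c| ≤ |J|`, and a piece off the unit neighbourhood of `supp J ⊂ Δ̃(y′)` vanishes;
* §3 the counting lemma `Σ_{y″ : |y″−y′|≤1} ≤ 3^d` (`sum_ball_le`, r02's `ballCard_distSite_le`);
* §4 **THE SUP MEMBERS TRANSPORTED**: from the (1.110) entries `m = 0, 1` of any product setting `latticeSettingP12R n M a ·` at constants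
  `(C, δ₀)` — hypotheses `hE0`, `hE1` in r02's field notation `eL`/`suppInL`/`supNormL` — the pointwise bounds `|(G_kJ)_μ(x)|, |(∇G_kJ)(x)| ≤
  3^d·C·e^{δ₀}e^{−δ₀|x_k − y′|}|J|` for `supp J ⊂ Δ̃(y′)` (p09's centred cube) at EVERY fine `x` (`abs_Gk_mulVec_le`, `abs_DGk_mulVec_le`), and the
  two genuine (1.110) entries of p09's `settingOf R k`: **`cubeSup_le`**, **`cubeSupG_le`** with `O(1) ↦ 3^d e^{2δ₀}·O(1)`, same `δ₀`.
HONEST SCOPE.  A transport of PROVED statements between two encodings; constants change by the factor `3^d e^{2δ₀}` (the 2^d … 3^d unit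
cubes meeting a centred cube), which the `∃ O(1)` of `B5.Prop12Printed` absorbs.  No Prop-valued definition, no new hypothesis bundle.
Unit `lit-balaban-p19` (literature-prover-lit-balaban-p19-g6-0), 2026-08-21.
-/

namespace Literature.MathematicalPhysics.QuantumFieldTheory.BalabanImbrieJaffe1984to88.BIJ85Prop12BridgeSup

open Literature.MathematicalPhysics.QuantumFieldTheory.Balaban1983to89
open scoped BigOperators Matrix
open LatticeFieldCalculus (supDist)
open B3TorusRadialSums (supDist_comm)
open B5Eq118OneStroke (iterBlockOf)
open B5Prop11Plancherel (Tor fine unitVec)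
open B5Prop11Lattice (grad)
open B5Prop11SettingModel (Loc189)
open B5DeltaA169 (DeltaA)
open B5Eq117TorusCarriers (Mk EK)
open B5Prop12FieldsLattice (distU distSite toFine cubeT cubeB suppInL supNormL eL)
open B5SettingP12Real (LocR)
open LatticeNorms (supNorm norm_le_supNorm supNorm_le supNorm_nonneg)
open BIJ85Ineq722Proof (Rep103)
open BIJ85Ineq722ProofPart2 (cubeSup cubeSupG settingOf)
open BIJ85Ineq722Torus (torusRep TorusData supDist_triangle)
open BIJ85Ineq722DeltaA (Gk DGk deltaAData)
open BIJ85Thm711TorusTransport (EK_shift)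
open BIJ85Prop12BridgeGeometry

noncomputable section

variable {P : Params} {k : ℕ}

/-! ## §1  The transported sources and the kernel dictionary -/

/-- the fine real vector field `J_μ(x)` of `T^{(0)}` read on the product torus and complexified: `J^c_μ(z) = J_μ(EK⁻¹ z)`.
[cite: Balaban1984PropagatorsI, Prop. 1.2 p.35 («J satisfying the condition supp J ⊂ Δ̃(y′)»)] -/
def srcC (hk : k ≤ P.m + P.K) (J : Balaban1983to89.Site P 0 × Fin P.d → ℝ) :
    Tor (fine (P.L ^ k) (Mk P k)) × Fin P.d → ℂ :=
  fun b => (J ((EK hk).symm b.1, b.2) : ℂ)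

/-- the same as r02's REAL source of vector kind (`B5SettingP12Real.LocR.vec`). [cite: Balaban1984PropagatorsI, Prop. 1.2 p.35] -/
def srcR (hk : k ≤ P.m + P.K) (J : Balaban1983to89.Site P 0 × Fin P.d → ℝ) : LocR (P.L ^ k) (Mk P k) :=
  .vec fun b => J ((EK hk).symm b.1, b.2)

/-- the embedded real source is the complexified one. [cite: Balaban1984PropagatorsI, Prop. 1.2 p.35] -/
@[simp] theorem emb_srcR (hk : k ≤ P.m + P.K) (J : Balaban1983to89.Site P 0 × Fin P.d → ℝ) :
    (srcR hk J).emb = .vec (srcC hk J) := rfl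

/-- unfolding of `srcC`. [cite: Balaban1984PropagatorsI, Prop. 1.2 p.35] -/
@[simp] theorem srcC_apply (hk : k ≤ P.m + P.K) (J : Balaban1983to89.Site P 0 × Fin P.d → ℝ)
    (b : Tor (fine (P.L ^ k) (Mk P k)) × Fin P.d) : srcC hk J b = (J ((EK hk).symm b.1, b.2) : ℂ) := rfl

/-- `srcC` is additive (finite sums). [cite: Balaban1984PropagatorsI, Prop. 1.2 p.35] -/
theorem srcC_sum (hk : k ≤ P.m + P.K) {ι : Type*} (s : Finset ι) (f : ι → Balaban1983to89.Site P 0 × Fin P.d → ℝ) :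
    srcC hk (∑ i ∈ s, f i) = ∑ i ∈ s, srcC hk (f i) := by
  funext b
  simp [srcC, Finset.sum_apply, Complex.ofReal_sum]

/-- `|J^c| ≤ |J|`: the sup norm of the transported source is at most the sup norm of `J`. [cite: Balaban1984PropagatorsI, (1.108) p.35] -/
theorem supNormL_srcR_le (hk : k ≤ P.m + P.K) (J : Balaban1983to89.Site P 0 × Fin P.d → ℝ) :
    supNormL (P.L ^ k) (Mk P k) (srcR hk J).emb ≤ ‖J‖ := by
  rw [emb_srcR]
  show supNorm Finset.univ (srcC hk J) ≤ ‖J‖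
  refine supNorm_le (norm_nonneg J) fun b _ => ?_
  rw [srcC_apply, Complex.norm_real]
  exact norm_le_pi_norm J _

/-- **THE KERNEL DICTIONARY, VALUES**: p09's `G_k = Gk hk a` acting on `J` IS the real part of r02's `(Δ_a)⁻¹ = (DeltaA (L^k) (Mk P k) a)⁻¹`
acting on `J^c`, read through `EK`. [cite: Balaban1984PropagatorsI, (1.71) p.30, (1.103) p.34] -/
theorem Gk_mulVec_apply (hk : k ≤ P.m + P.K) (a : ℝ) (J : Balaban1983to89.Site P 0 × Fin P.d → ℝ)
    (x : Balaban1983to89.Site P 0) (μ : Fin P.d) :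
    (Gk hk a *ᵥ J) (x, μ) = (((DeltaA (P.L ^ k) (Mk P k) a)⁻¹ *ᵥ srcC hk J) (EK hk x, μ)).re := by
  classical
  simp only [Matrix.mulVec, dotProduct]
  rw [Complex.re_sum, ← Equiv.sum_comp ((EK hk).prodCongr (Equiv.refl (Fin P.d)))]
  refine Finset.sum_congr rfl fun j _ => ?_
  obtain ⟨z, ν⟩ := j
  show Gk hk a (x, μ) (z, ν) * J (z, ν)
    = ((DeltaA (P.L ^ k) (Mk P k) a)⁻¹ (EK hk x, μ) (EK hk z, ν) * srcC hk J (EK hk z, ν)).re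
  rw [srcC_apply, Equiv.symm_apply_apply, Complex.re_mul_ofReal]
  rfl

/-- r02's forward gradient componentwise: `(∇_λ F)_μ(z) = n(F_μ(z + e_λ) − F_μ(z))`. [cite: Balaban1984PropagatorsI, (1.31) p.23] -/
theorem grad_apply {d : ℕ} (n : ℕ) [NeZero n] (M : Fin d → ℕ) [∀ μ, NeZero (M μ)] (F : Tor (fine n M) × Fin d → ℂ)
    (lam : Fin d) (z : Tor (fine n M)) (μ : Fin d) :
    grad n M F lam (z, μ) = (n : ℂ) * (F (z + unitVec (fine n M) lam, μ) - F (z, μ)) := by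
  simp only [grad, B5Prop11Plancherel.fdiff, Matrix.smul_mulVec, Matrix.sub_mulVec, Matrix.one_mulVec, Pi.smul_apply,
    Pi.sub_apply, B5Action121.shiftM_mulVec, smul_eq_mul]

/-- p09's gradient kernel acting on `J` is `L^k` times the forward difference of `G_kJ`. [cite: Balaban1984PropagatorsI, (1.108) p.35] -/
theorem DGk_mulVec_eq (hk : k ≤ P.m + P.K) (a : ℝ) (J : Balaban1983to89.Site P 0 × Fin P.d → ℝ)
    (x : Balaban1983to89.Site P 0) (lam μ : Fin P.d) :
    (DGk hk a *ᵥ J) (x, lam, μ) = (P.L : ℝ) ^ k * ((Gk hk a *ᵥ J) (x.shift lam, μ) - (Gk hk a *ᵥ J) (x, μ)) := by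
  simp only [Matrix.mulVec, dotProduct, DGk, Finset.mul_sum, ← Finset.sum_sub_distrib]
  refine Finset.sum_congr rfl fun j _ => ?_
  ring

/-- **THE KERNEL DICTIONARY, GRADIENTS**: p09's `∇G_k = DGk hk a` acting on `J` IS the real part of r02's `grad (Δ_a⁻¹ J^c)`, read through `EK`
(`EK (x + e_λ) = EK x + e_λ`). [cite: Balaban1984PropagatorsI, (1.108) p.35, (1.103) p.34] -/
theorem DGk_mulVec_apply (hk : k ≤ P.m + P.K) (a : ℝ) (J : Balaban1983to89.Site P 0 × Fin P.d → ℝ)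
    (x : Balaban1983to89.Site P 0) (lam μ : Fin P.d) :
    (DGk hk a *ᵥ J) (x, lam, μ)
      = (grad (P.L ^ k) (Mk P k) ((DeltaA (P.L ^ k) (Mk P k) a)⁻¹ *ᵥ srcC hk J) lam (EK hk x, μ)).re := by
  rw [DGk_mulVec_eq, Gk_mulVec_apply, Gk_mulVec_apply, EK_shift, grad_apply, Complex.mul_re, Complex.sub_re, Complex.sub_im,
    Complex.natCast_re, Complex.natCast_im, zero_mul, sub_zero, Nat.cast_pow]

/-! ## §2  Supports and block pieces through the dictionary -/

/-- the block piece `J1_{Δ(y″)}` of a fine vector field (p09's `Rep103.blockRestr` for the carrier `torusRep`, on the concrete index type;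
`blockPiece_eq_blockRestr`). [cite: Balaban1984PropagatorsI, (1.110) p.35 («Δ(y) = B^k(y)»)] -/
def blockPiece (k : ℕ) (J : Balaban1983to89.Site P 0 × Fin P.d → ℝ) (y'' : Balaban1983to89.Site P k) :
    Balaban1983to89.Site P 0 × Fin P.d → ℝ :=
  fun j => if iterBlockOf k j.1 = y'' then J j else 0

/-- `blockPiece` IS p09's `blockRestr` for the torus carrier (definitional). [cite: Balaban1984PropagatorsI, (1.110) p.35] -/
theorem blockPiece_eq_blockRestr (D : TorusData P k) (J : Balaban1983to89.Site P 0 × Fin P.d → ℝ) (y'' : Balaban1983to89.Site P k) :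
    blockPiece k J y'' = (torusRep P k D).blockRestr J y'' := rfl

/-- `J = Σ_{y″} J1_{Δ(y″)}`. [cite: Balaban1984PropagatorsI, (1.110) p.35] -/
theorem sum_blockPiece (J : Balaban1983to89.Site P 0 × Fin P.d → ℝ) : ∑ y'', blockPiece k J y'' = J := by
  funext j
  simp only [Finset.sum_apply, blockPiece, Finset.sum_ite_eq, Finset.mem_univ, if_true]

/-- **the block pieces are supported in the product cubes**: `supp (J1_{Δ(y″)})^c ⊂ Δ̃(y″)` in r02's sense (`suppInL`).
[cite: Balaban1984PropagatorsI, p.35 («Δ(y) = B^k(y)», «Δ̃(y) … having the point y as a corner»)] -/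
theorem suppInL_srcR_blockPiece (hk : k ≤ P.m + P.K) (J : Balaban1983to89.Site P 0 × Fin P.d → ℝ)
    (y'' : Balaban1983to89.Site P k) :
    suppInL (P.L ^ k) (Mk P k) (srcR hk (blockPiece k J y'')).emb y'' := by
  intro b hb
  have hb' : blockPiece k J y'' ((EK hk).symm b.1, b.2) ≠ 0 := fun h0 => hb (by
    show ((blockPiece k J y'' ((EK hk).symm b.1, b.2) : ℝ) : ℂ) = 0
    rw [h0, Complex.ofReal_zero])
  unfold blockPiece at hb'
  split_ifs at hb' with hy
  · have h := EK_mem_cubeT_blk hk ((EK hk).symm b.1)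
    rwa [Equiv.apply_symm_apply, hy] at h
  · exact absurd rfl hb'

/-- `|J1_{Δ(y″)}| ≤ |J|`. [cite: Balaban1984PropagatorsI, (1.108) p.35] -/
theorem norm_blockPiece_le (J : Balaban1983to89.Site P 0 × Fin P.d → ℝ) (y'' : Balaban1983to89.Site P k) :
    ‖blockPiece k J y''‖ ≤ ‖J‖ := by
  refine (pi_norm_le_iff_of_nonneg (norm_nonneg J)).2 fun j => ?_
  unfold blockPiece
  split_ifs
  · exact norm_le_pi_norm J j
  · rw [norm_zero]; exact norm_nonneg J

/-- **a block piece off the unit neighbourhood of the support vanishes**: if `supp J ⊂ Δ̃(y′) = {x : |x − ctr y′|_∞ < L^k}` (p09's centred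
cube) and `|y″ − y′|_∞ > 1` then `J1_{Δ(y″)} = 0`. [cite: Balaban1984PropagatorsI, p.35 (the cubes Δ(y), Δ̃(y))] -/
theorem blockPiece_eq_zero_of_far (hk : k ≤ P.m + P.K) {J : Balaban1983to89.Site P 0 × Fin P.d → ℝ}
    {y' y'' : Balaban1983to89.Site P k} (hJ : ∀ i, J i ≠ 0 → supDist i.1 (BIJ85Ineq722Torus.ctr k y') < P.L ^ k)
    (hfar : ¬ supDist y'' y' ≤ 1) : blockPiece k J y'' = 0 := by
  funext j
  rw [Pi.zero_apply]
  unfold blockPiece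
  split_ifs with hb
  · by_contra hJj
    have hx : j.1 ∈ (torusRep P k (BIJ85Ineq722Torus.stdData k 0 0)).cube y' :=
      (mem_cube_iff_supDist_lt _ y' j.1).mpr (hJ j hJj)
    exact hfar (hb ▸ supDist_blk_le_one_of_mem_cube hk _ hx)
  · rfl

/-! ## §3  Counting the unit cubes near the support -/

/-- **`#{y″ ∈ T^{(k)} : |y″ − y′|_∞ ≤ 1} ≤ 3^d`**, as a summation bound: a family of reals vanishing off the unit ball about `y′` and
bounded by `B ≥ 0` on it sums to at most `3^d·B` (r02's `ballCard_distSite_le`). [cite: Balaban1984PropagatorsI, p.36 (the cubes parametrized by T₁^{(k)})] -/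
theorem sum_ball_le (y' : Balaban1983to89.Site P k) {B : ℝ} (hB : 0 ≤ B) (T : Balaban1983to89.Site P k → ℝ)
    (hT : ∀ y'', T y'' ≤ if supDist y'' y' ≤ 1 then B else 0) : ∑ y'', T y'' ≤ 3 ^ P.d * B := by
  classical
  have h1 : ∑ y'', T y'' ≤ ∑ y'' : Balaban1983to89.Site P k, (if supDist y'' y' ≤ 1 then B else 0) :=
    Finset.sum_le_sum fun y'' _ => hT y''
  rw [Finset.sum_ite, Finset.sum_const_zero, add_zero, Finset.sum_const, nsmul_eq_mul] at h1
  have h : (((Finset.univ.filter fun w : Balaban1983to89.Site P k => distSite (Mk P k) y' w ≤ 1).card : ℕ) : ℝ)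
      ≤ (2 * ⌊(1 : ℝ)⌋₊ + 1 : ℝ) ^ P.d :=
    B5RowSumsP12Lattice.ballCard_distSite_le (Mk P k) y' zero_le_one
  have e : (Finset.univ.filter fun w : Balaban1983to89.Site P k => distSite (Mk P k) y' w ≤ 1)
      = Finset.univ.filter fun y'' : Balaban1983to89.Site P k => supDist y'' y' ≤ 1 := by
    refine Finset.filter_congr fun w _ => ?_
    rw [← supDist_cast_eq_distSite, supDist_comm, Nat.cast_le_one]
  have h3 : (2 * (⌊(1 : ℝ)⌋₊ : ℝ) + 1) = 3 := by norm_num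
  rw [e, h3] at h
  exact h1.trans (mul_le_mul_of_nonneg_right h hB)

/-! ## §4  The sup members (1.110), n = 0, 1, transported -/

section Sup

variable (hk : k ≤ P.m + P.K) (a : ℝ) {C δ₀ : ℝ}

/-- the decay factor bookkeeping: `|w − y″| ≥ |w − y′| − 1` for `|y″ − y′| ≤ 1`. [cite: Balaban1984PropagatorsI, Prop. 1.2 (1.110) p.35] -/
theorem exp_blk_le (hδ : 0 ≤ δ₀) {w y' y'' : Balaban1983to89.Site P k} (h : supDist y'' y' ≤ 1) :
    Real.exp (-(δ₀ * distSite (Mk P k) w y'')) ≤ Real.exp δ₀ * Real.exp (-(δ₀ * supDist w y')) := by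
  rw [← supDist_cast_eq_distSite, ← Real.exp_add]
  apply Real.exp_le_exp.mpr
  have h1 := supDist_triangle w y'' y'
  have h2 : (supDist w y' : ℝ) ≤ supDist w y'' + 1 := by exact_mod_cast h1.trans (Nat.add_le_add_left h _)
  nlinarith

/-- one block piece of the value, near the support. [cite: Balaban1984PropagatorsI, Prop. 1.2 (1.110) p.35] -/
theorem norm_G_srcC_blockPiece_le (hC : 0 ≤ C) (hδ : 0 ≤ δ₀)
    (hE0 : ∀ (J : LocR (P.L ^ k) (Mk P k)) (y y' : Tor (Mk P k)), suppInL (P.L ^ k) (Mk P k) J.emb y' →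
      eL (P.L ^ k) (Mk P k) a 0 J.emb y ≤ C * Real.exp (-(δ₀ * distSite (Mk P k) y y')) * supNormL (P.L ^ k) (Mk P k) J.emb)
    (J : Balaban1983to89.Site P 0 × Fin P.d → ℝ) {y' y'' : Balaban1983to89.Site P k} (hnear : supDist y'' y' ≤ 1)
    (x : Balaban1983to89.Site P 0) (μ : Fin P.d) :
    ‖((DeltaA (P.L ^ k) (Mk P k) a)⁻¹ *ᵥ srcC hk (blockPiece k J y'')) (EK hk x, μ)‖
      ≤ C * Real.exp δ₀ * Real.exp (-(δ₀ * supDist (iterBlockOf k x) y')) * ‖J‖ := by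
  have hmem : (EK hk x, μ) ∈ cubeB (P.L ^ k) (Mk P k) (iterBlockOf k x) :=
    Finset.mem_product.mpr ⟨EK_mem_cubeT_blk hk x, Finset.mem_univ _⟩
  have h1 : ‖((DeltaA (P.L ^ k) (Mk P k) a)⁻¹ *ᵥ srcC hk (blockPiece k J y'')) (EK hk x, μ)‖
      ≤ eL (P.L ^ k) (Mk P k) a 0 (srcR hk (blockPiece k J y'')).emb (iterBlockOf k x) := by
    rw [emb_srcR, B5Prop12FieldsLattice.eL_zero_vec]
    exact norm_le_supNorm (f := (DeltaA (P.L ^ k) (Mk P k) a)⁻¹ *ᵥ srcC hk (blockPiece k J y'')) hmem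
  have h2 := hE0 (srcR hk (blockPiece k J y'')) (iterBlockOf k x) y'' (suppInL_srcR_blockPiece hk J y'')
  have h3 := (supNormL_srcR_le hk (blockPiece k J y'')).trans (norm_blockPiece_le J y'')
  have h4 := exp_blk_le (w := iterBlockOf k x) hδ hnear
  have h5 : 0 ≤ supNormL (P.L ^ k) (Mk P k) (srcR hk (blockPiece k J y'')).emb := B5Prop12FieldsLattice.supNormL_nonneg _
  calc ‖((DeltaA (P.L ^ k) (Mk P k) a)⁻¹ *ᵥ srcC hk (blockPiece k J y'')) (EK hk x, μ)‖
      ≤ C * Real.exp (-(δ₀ * distSite (Mk P k) (iterBlockOf k x) y'')) * supNormL (P.L ^ k) (Mk P k) (srcR hk (blockPiece k J y'')).emb :=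
        h1.trans h2
    _ ≤ C * (Real.exp δ₀ * Real.exp (-(δ₀ * supDist (iterBlockOf k x) y'))) * ‖J‖ := by gcongr
    _ = C * Real.exp δ₀ * Real.exp (-(δ₀ * supDist (iterBlockOf k x) y')) * ‖J‖ := by ring

/-- one block piece of the gradient, near the support. [cite: Balaban1984PropagatorsI, Prop. 1.2 (1.110) p.35] -/
theorem norm_grad_srcC_blockPiece_le (hC : 0 ≤ C) (hδ : 0 ≤ δ₀)
    (hE1 : ∀ (J : LocR (P.L ^ k) (Mk P k)) (y y' : Tor (Mk P k)), suppInL (P.L ^ k) (Mk P k) J.emb y' →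
      eL (P.L ^ k) (Mk P k) a 1 J.emb y ≤ C * Real.exp (-(δ₀ * distSite (Mk P k) y y')) * supNormL (P.L ^ k) (Mk P k) J.emb)
    (J : Balaban1983to89.Site P 0 × Fin P.d → ℝ) {y' y'' : Balaban1983to89.Site P k} (hnear : supDist y'' y' ≤ 1)
    (x : Balaban1983to89.Site P 0) (lam μ : Fin P.d) :
    ‖grad (P.L ^ k) (Mk P k) ((DeltaA (P.L ^ k) (Mk P k) a)⁻¹ *ᵥ srcC hk (blockPiece k J y'')) lam (EK hk x, μ)‖
      ≤ C * Real.exp δ₀ * Real.exp (-(δ₀ * supDist (iterBlockOf k x) y')) * ‖J‖ := by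
  have hmem : (lam, (EK hk x, μ)) ∈ Finset.univ ×ˢ cubeB (P.L ^ k) (Mk P k) (iterBlockOf k x) :=
    Finset.mem_product.mpr ⟨Finset.mem_univ _, Finset.mem_product.mpr ⟨EK_mem_cubeT_blk hk x, Finset.mem_univ _⟩⟩
  have h1 : ‖grad (P.L ^ k) (Mk P k) ((DeltaA (P.L ^ k) (Mk P k) a)⁻¹ *ᵥ srcC hk (blockPiece k J y'')) lam (EK hk x, μ)‖
      ≤ eL (P.L ^ k) (Mk P k) a 1 (srcR hk (blockPiece k J y'')).emb (iterBlockOf k x) := by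
    rw [emb_srcR, B5Prop12FieldsLattice.eL_one_vec]
    have h := norm_le_supNorm (fun p : Fin P.d × (Tor (fine (P.L ^ k) (Mk P k)) × Fin P.d) =>
      grad (P.L ^ k) (Mk P k) ((DeltaA (P.L ^ k) (Mk P k) a)⁻¹ *ᵥ srcC hk (blockPiece k J y'')) p.1 p.2) hmem
    dsimp only at h
    exact h
  have h2 := hE1 (srcR hk (blockPiece k J y'')) (iterBlockOf k x) y'' (suppInL_srcR_blockPiece hk J y'')
  have h3 := (supNormL_srcR_le hk (blockPiece k J y'')).trans (norm_blockPiece_le J y'')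
  have h4 := exp_blk_le (w := iterBlockOf k x) hδ hnear
  have h5 : 0 ≤ supNormL (P.L ^ k) (Mk P k) (srcR hk (blockPiece k J y'')).emb := B5Prop12FieldsLattice.supNormL_nonneg _
  calc ‖grad (P.L ^ k) (Mk P k) ((DeltaA (P.L ^ k) (Mk P k) a)⁻¹ *ᵥ srcC hk (blockPiece k J y'')) lam (EK hk x, μ)‖
      ≤ C * Real.exp (-(δ₀ * distSite (Mk P k) (iterBlockOf k x) y'')) * supNormL (P.L ^ k) (Mk P k) (srcR hk (blockPiece k J y'')).emb :=
        h1.trans h2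
    _ ≤ C * (Real.exp δ₀ * Real.exp (-(δ₀ * supDist (iterBlockOf k x) y'))) * ‖J‖ := by gcongr
    _ = C * Real.exp δ₀ * Real.exp (-(δ₀ * supDist (iterBlockOf k x) y')) * ‖J‖ := by ring

/-- **THE VALUE BOUND AT EVERY FINE POINT**: from the (1.110) entry `m = 0` of the product setting at `(C, δ₀)`, for
`supp J ⊂ Δ̃(y′) = {x : |x − ctr y′|_∞ < L^k}` (p09's centred cube): `|(G_kJ)_μ(x)| ≤ 3^d·C·e^{δ₀}·e^{−δ₀|x_k − y′|_∞}·|J|`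
(`x_k` = the `k`-block of `x`). [cite: Balaban1984PropagatorsI, Prop. 1.2 (1.110) p.35] -/
theorem abs_Gk_mulVec_le (hC : 0 ≤ C) (hδ : 0 ≤ δ₀)
    (hE0 : ∀ (J : LocR (P.L ^ k) (Mk P k)) (y y' : Tor (Mk P k)), suppInL (P.L ^ k) (Mk P k) J.emb y' →
      eL (P.L ^ k) (Mk P k) a 0 J.emb y ≤ C * Real.exp (-(δ₀ * distSite (Mk P k) y y')) * supNormL (P.L ^ k) (Mk P k) J.emb)
    {J : Balaban1983to89.Site P 0 × Fin P.d → ℝ} {y' : Balaban1983to89.Site P k}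
    (hJ : ∀ i, J i ≠ 0 → supDist i.1 (BIJ85Ineq722Torus.ctr k y') < P.L ^ k) (x : Balaban1983to89.Site P 0) (μ : Fin P.d) :
    |(Gk hk a *ᵥ J) (x, μ)| ≤ 3 ^ P.d * (C * Real.exp δ₀ * Real.exp (-(δ₀ * supDist (iterBlockOf k x) y')) * ‖J‖) := by
  classical
  -- split `J` into its block pieces
  have hsplit : (Gk hk a *ᵥ J) (x, μ) = ∑ y'', (Gk hk a *ᵥ blockPiece k J y'') (x, μ) := by
    conv_lhs => rw [← sum_blockPiece (k := k) J]
    rw [Matrix.mulVec_sum, Finset.sum_apply]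
  rw [hsplit]
  refine (Finset.abs_sum_le_sum_abs _ _).trans (sum_ball_le y' (by positivity) _ fun y'' => ?_)
  split_ifs with hnear
  · rw [Gk_mulVec_apply]
    exact (Complex.abs_re_le_norm _).trans (norm_G_srcC_blockPiece_le hk a hC hδ hE0 J hnear x μ)
  · rw [blockPiece_eq_zero_of_far hk hJ hnear, Matrix.mulVec_zero, Pi.zero_apply, abs_zero]

/-- **THE GRADIENT BOUND AT EVERY FINE POINT**: from the (1.110) entry `m = 1` of the product setting at `(C, δ₀)`, for `supp J ⊂ Δ̃(y′)`:
`|(∇_λG_kJ)_μ(x)| ≤ 3^d·C·e^{δ₀}·e^{−δ₀|x_k − y′|_∞}·|J|`. [cite: Balaban1984PropagatorsI, Prop. 1.2 (1.110) p.35] -/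
theorem abs_DGk_mulVec_le (hC : 0 ≤ C) (hδ : 0 ≤ δ₀)
    (hE1 : ∀ (J : LocR (P.L ^ k) (Mk P k)) (y y' : Tor (Mk P k)), suppInL (P.L ^ k) (Mk P k) J.emb y' →
      eL (P.L ^ k) (Mk P k) a 1 J.emb y ≤ C * Real.exp (-(δ₀ * distSite (Mk P k) y y')) * supNormL (P.L ^ k) (Mk P k) J.emb)
    {J : Balaban1983to89.Site P 0 × Fin P.d → ℝ} {y' : Balaban1983to89.Site P k}
    (hJ : ∀ i, J i ≠ 0 → supDist i.1 (BIJ85Ineq722Torus.ctr k y') < P.L ^ k) (x : Balaban1983to89.Site P 0) (lam μ : Fin P.d) :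
    |(DGk hk a *ᵥ J) (x, lam, μ)| ≤ 3 ^ P.d * (C * Real.exp δ₀ * Real.exp (-(δ₀ * supDist (iterBlockOf k x) y')) * ‖J‖) := by
  classical
  have hsplit : (DGk hk a *ᵥ J) (x, lam, μ) = ∑ y'', (DGk hk a *ᵥ blockPiece k J y'') (x, lam, μ) := by
    conv_lhs => rw [← sum_blockPiece (k := k) J]
    rw [Matrix.mulVec_sum, Finset.sum_apply]
  rw [hsplit]
  refine (Finset.abs_sum_le_sum_abs _ _).trans (sum_ball_le y' (by positivity) _ fun y'' => ?_)
  split_ifs with hnear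
  · rw [DGk_mulVec_apply]
    exact (Complex.abs_re_le_norm _).trans (norm_grad_srcC_blockPiece_le hk a hC hδ hE1 J hnear x lam μ)
  · rw [blockPiece_eq_zero_of_far hk hJ hnear, Matrix.mulVec_zero, Pi.zero_apply, abs_zero]

include hk in
/-- the decay factor bookkeeping on the other side: for `x ∈ Δ̃(y)` (p09's centred cube, `|x − ctr y|_∞ < L^k`) `|x_k − y′| ≥ |y − y′| − 1`.
[cite: Balaban1984PropagatorsI, Prop. 1.2 (1.110) p.35] -/
theorem exp_cube_le (hδ : 0 ≤ δ₀) {x : Balaban1983to89.Site P 0} {y y' : Balaban1983to89.Site P k}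
    (hx : supDist x (BIJ85Ineq722Torus.ctr k y) < P.L ^ k) :
    Real.exp (-(δ₀ * supDist (iterBlockOf k x) y')) ≤ Real.exp δ₀ * Real.exp (-(δ₀ * supDist y y')) := by
  rw [← Real.exp_add]
  apply Real.exp_le_exp.mpr
  have hx' : x ∈ (torusRep P k (BIJ85Ineq722Torus.stdData k 0 0)).cube y := (mem_cube_iff_supDist_lt _ y x).mpr hx
  have h0 := supDist_blk_le_one_of_mem_cube hk _ hx'
  have h1 := supDist_triangle y (iterBlockOf k x) y'
  rw [supDist_comm y (iterBlockOf k x)] at h1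
  have h2 : (supDist y y' : ℝ) ≤ 1 + supDist (iterBlockOf k x) y' := by exact_mod_cast h1.trans (Nat.add_le_add_right h0 _)
  nlinarith

/-- **(1.110), n = 0, FOR p09's CUBES**: `|(G_kJ)_μ(x)| ≤ 3^d e^{2δ₀}·O(1)·e^{−δ₀|y−y′|}|J|` for `x ∈ Δ̃(y)`, `supp J ⊂ Δ̃(y′)` (centred cubes
`|· − ctr|_∞ < L^k`), from the `m = 0` entry of the product setting. [cite: Balaban1984PropagatorsI, Prop. 1.2 (1.110) p.35] -/
theorem abs_Gk_mulVec_le_of_mem_cube (hC : 0 ≤ C) (hδ : 0 ≤ δ₀)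
    (hE0 : ∀ (J : LocR (P.L ^ k) (Mk P k)) (y y' : Tor (Mk P k)), suppInL (P.L ^ k) (Mk P k) J.emb y' →
      eL (P.L ^ k) (Mk P k) a 0 J.emb y ≤ C * Real.exp (-(δ₀ * distSite (Mk P k) y y')) * supNormL (P.L ^ k) (Mk P k) J.emb)
    {J : Balaban1983to89.Site P 0 × Fin P.d → ℝ} {y y' : Balaban1983to89.Site P k}
    (hJ : ∀ i, J i ≠ 0 → supDist i.1 (BIJ85Ineq722Torus.ctr k y') < P.L ^ k) {x : Balaban1983to89.Site P 0}
    (hx : supDist x (BIJ85Ineq722Torus.ctr k y) < P.L ^ k) (μ : Fin P.d) :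
    |(Gk hk a *ᵥ J) (x, μ)| ≤ 3 ^ P.d * Real.exp (2 * δ₀) * C * Real.exp (-(δ₀ * supDist y y')) * ‖J‖ := by
  have h1 := abs_Gk_mulVec_le hk a hC hδ hE0 hJ x μ
  have h2 := exp_cube_le hk hδ (y' := y') hx
  calc |(Gk hk a *ᵥ J) (x, μ)| ≤ 3 ^ P.d * (C * Real.exp δ₀ * Real.exp (-(δ₀ * supDist (iterBlockOf k x) y')) * ‖J‖) := h1
    _ ≤ 3 ^ P.d * (C * Real.exp δ₀ * (Real.exp δ₀ * Real.exp (-(δ₀ * supDist y y'))) * ‖J‖) := by gcongr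
    _ = 3 ^ P.d * Real.exp (2 * δ₀) * C * Real.exp (-(δ₀ * supDist y y')) * ‖J‖ := by
        rw [show (2 : ℝ) * δ₀ = δ₀ + δ₀ by ring, Real.exp_add]; ring

/-- **(1.110), n = 1, FOR p09's CUBES**: `|(∇_λG_kJ)_μ(x)| ≤ 3^d e^{2δ₀}·O(1)·e^{−δ₀|y−y′|}|J|` for `x ∈ Δ̃(y)`, `supp J ⊂ Δ̃(y′)`.
[cite: Balaban1984PropagatorsI, Prop. 1.2 (1.110) p.35] -/
theorem abs_DGk_mulVec_le_of_mem_cube (hC : 0 ≤ C) (hδ : 0 ≤ δ₀)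
    (hE1 : ∀ (J : LocR (P.L ^ k) (Mk P k)) (y y' : Tor (Mk P k)), suppInL (P.L ^ k) (Mk P k) J.emb y' →
      eL (P.L ^ k) (Mk P k) a 1 J.emb y ≤ C * Real.exp (-(δ₀ * distSite (Mk P k) y y')) * supNormL (P.L ^ k) (Mk P k) J.emb)
    {J : Balaban1983to89.Site P 0 × Fin P.d → ℝ} {y y' : Balaban1983to89.Site P k}
    (hJ : ∀ i, J i ≠ 0 → supDist i.1 (BIJ85Ineq722Torus.ctr k y') < P.L ^ k) {x : Balaban1983to89.Site P 0}
    (hx : supDist x (BIJ85Ineq722Torus.ctr k y) < P.L ^ k) (lam μ : Fin P.d) :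
    |(DGk hk a *ᵥ J) (x, lam, μ)| ≤ 3 ^ P.d * Real.exp (2 * δ₀) * C * Real.exp (-(δ₀ * supDist y y')) * ‖J‖ := by
  have h1 := abs_DGk_mulVec_le hk a hC hδ hE1 hJ x lam μ
  have h2 := exp_cube_le hk hδ (y' := y') hx
  calc |(DGk hk a *ᵥ J) (x, lam, μ)| ≤ 3 ^ P.d * (C * Real.exp δ₀ * Real.exp (-(δ₀ * supDist (iterBlockOf k x) y')) * ‖J‖) := h1
    _ ≤ 3 ^ P.d * (C * Real.exp δ₀ * (Real.exp δ₀ * Real.exp (-(δ₀ * supDist y y'))) * ‖J‖) := by gcongr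
    _ = 3 ^ P.d * Real.exp (2 * δ₀) * C * Real.exp (-(δ₀ * supDist y y')) * ‖J‖ := by
        rw [show (2 : ℝ) * δ₀ = δ₀ + δ₀ by ring, Real.exp_add]; ring

end Sup

end

end Literature.MathematicalPhysics.QuantumFieldTheory.BalabanImbrieJaffe1984to88.BIJ85Prop12BridgeSup
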